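import Summits.Ventures.HSemireg.Mod4LeadingTermPinCriterion

/-!
# Venture HSemireg — MOD-4 line: the `I_Z`-SHAPE h-parts (`q_0 ≠ 0`, `q_1 = … = q_{n−1} = 0`, `q_n ≠ 0`, any tail) at the
# EXTREME `O_Z` pin `t_0 = q_n²` of an even `n`: `T_f` is the triangular `O_Z` matrix plus `q_0` in the corner `(n, 0)`, and
# `dim ker(T_f − q_n) = [det B_0 = 0]` — the `I_Z` row drops there EXACTLY on the `O_Z` drop-2 hypersurface

HONEST FRAMING. Part of the Lean index of the computation cell `pub-hsemireg` (seat w3-mod4-1 gen 15, W3 SPECIAL FIBRES; file of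
record `HOME/widen/W3/MOD4-OFFSPLIT-w3mod4.md` §8 (TABLE R's «1 − ch(O_Z)» row: «no locus at the sampled J») and §13.33). First
kernel statement on the `I_Z`-shape middle: ELEMENTARY LINEAR ALGEBRA over a field ONLY — no abelian variety, no sheaf, no Ext group,
no semiregularity map; nothing here says that HC / HC_CM / HC_AV holds; no Literature fact is declared; NO definition is introduced.

SETTING: `q⁰ := q[0 ↦ 0]` is the `O_Z` part (a leading shape: `q⁰_m = 0` for `m < n`), `T_f(q) = T_f(q⁰) + q_0·E_{n,0}`
(`hankelT_mulVec_idealShape`); `n` even, `μ_0 = q_n` (the pin value at `a = 0`; `t_0 = (−1)ⁿ μ_0² = q_n²`), `N = T_f(q⁰) − μ_0`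
(upper triangular, zero pivots at `0` and `n`), `B_0 = (N_{r, 1+s})_{r,s<n}` its `n × n` pin block.  WHAT IS PROVED:
* **`eq_zero_of_mulVec_eq_zero_of_apply_two_pivots`** — general: `N` upper triangular with non-zero pivots off `{i, i+k}`,
  `Nv = 0`, `v_i = v_{i+k} = 0` ⇒ `v = 0`;
* **`hankelT_mulVec_idealShape`** — `(T_f(q) v)_b = (T_f(q⁰) v)_b + [b = n]·q_0 v_0`;
* **`apply_zero_eq_zero_of_mem_ker_idealShape_pin_zero`** — `v ∈ ker(T_f(q) − q_n)` ⇒ `v_0 = 0` (row `n`: the pivot there is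
  `(−1)ⁿq_n − q_n = 0`, so the row reads `q_0 v_0 = 0`) and hence `v ∈ ker(T_f(q⁰) − q_n)`;
* **`ker_hankelT_idealShape_pin_zero_eq_bot`** — `det B_0 ≠ 0` ⇒ `ker(T_f(q) − q_n) = ⊥` (`Mod4LeadingTermPinCriterion` on `q⁰`);
* **`finrank_ker_hankelT_idealShape_pin_zero`** — `det B_0 = 0` ⇒ `dim ker(T_f(q) − q_n) = 1` (`≥ 1`: the `2`-dimensional
  `ker(T_f(q⁰) − q_n)` meets `{v_0 = 0}`; `≤ 1`: `v ↦ v_n` is injective there by the two-pivot lemma);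
* **`finrank_ker_hankelT_idealShape_add_pin_zero_le_one`** — `dim ker(T_f(q) + q_n) ≤ 1` (`v ↦ v_0` is injective: `T_f(q⁰) + q_n` is
  triangular with NO zero pivot for even `n`);
* **`finrank_ker_middleM_idealShape_pin_zero_of_det_eq_zero ∕ _of_det_ne_zero ∕ _le_two`** —
  `dim ker(M_f(q) − q_n²) = [det B_0 = 0] + dim ker(T_f(q) + q_n) ∈ {0, 1, 2}` (`Mod4MiddleKernelSplit`).
READING: §8's `I_Z` row showed no drop at the sampled pins; here, at the extreme pin `q_n²` of an even `n`, the `I_Z` row DOES drop —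
by exactly the `O_Z` drop-2 bit `[det B_0 = 0]` (`n = 2`: `3q₂q₄ = 2q₃²`; `n = 4`: the weight-20 quartic) — plus a second bit
`[det(T_f + q_n) = 0]`, a further hypersurface in `(q_0, q_{n+1}, …, q_{2n})`. Everything PROVED, 0 sorry. Namespace
`Summit.Ventures.HSemireg.Mod4`. References: [BourbakiAlgebre1a3] Ch. III §8; [BuchweitzFlenner2008HH] Prop. 6.4.4 (why these matrices).
-/

namespace Summit.Ventures.HSemireg.Mod4

open Finset Matrix

variable {K : Type*} [Field K]

/-- **two pivots removed, back substitution:** `N` upper triangular with non-zero pivots off `{i, i+k}`, `Nv = 0`, `v_i = 0`,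
`v_{i+k} = 0` ⇒ `v = 0`. [cite: BourbakiAlgebre1a3, Ch. III §8] -/
theorem eq_zero_of_mulVec_eq_zero_of_apply_two_pivots {m : ℕ} {N : Matrix (Fin (m + 1)) (Fin (m + 1)) K}
    (htri : N.BlockTriangular id) {i k : ℕ} (hik : i + k ≤ m)
    (hpiv : ∀ b : Fin (m + 1), (b : ℕ) ≠ i → (b : ℕ) ≠ i + k → N b b ≠ 0)
    {v : Fin (m + 1) → K} (hv : N *ᵥ v = 0) (hvi : v ⟨i, by omega⟩ = 0) (hvik : v ⟨i + k, by omega⟩ = 0) : v = 0 := by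
  have hrow : ∀ b : Fin (m + 1), ∑ c : Fin (m + 1), N b c * v c = 0 := by
    intro b
    have h := congr_fun hv b
    simp only [Matrix.mulVec, dotProduct, Pi.zero_apply] at h
    exact h
  have key : ∀ j, j ≤ m → v ⟨m - j, by omega⟩ = 0 := by
    intro j
    refine Nat.strong_induction_on j ?_
    intro j ih hj
    set b : Fin (m + 1) := ⟨m - j, by omega⟩ with hb
    by_cases hbi : (b : ℕ) = i
    · have : b = ⟨i, by omega⟩ := Fin.ext hbi
      rw [this]; exact hvi
    by_cases hbik : (b : ℕ) = i + k
    · have : b = ⟨i + k, by omega⟩ := Fin.ext hbik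
      rw [this]; exact hvik
    have hp := pivot_mul_eq_zero_of_row htri b (hrow b) (fun c hc => by
      have hcl := c.isLt
      have hc' : (b : ℕ) < (c : ℕ) := hc
      have h' := ih (m - (c : ℕ)) (by simp only [hb] at hc'; omega) (by omega)
      have hfin : (⟨m - (m - (c : ℕ)), by omega⟩ : Fin (m + 1)) = c := Fin.ext (by simp only; omega)
      rwa [hfin] at h')
    rcases mul_eq_zero.mp hp with h | h
    · exact absurd h (hpiv b hbi hbik)
    · exact h
  funext c
  have hcl := c.isLt
  have h := key (m - (c : ℕ)) (by omega)
  have hfin : (⟨m - (m - (c : ℕ)), by omega⟩ : Fin (m + 1)) = c := Fin.ext (by simp only; omega)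
  rwa [hfin] at h

/-! ### `T_f` of an `I_Z` shape = `T_f` of its `O_Z` part + `q_0` in the corner `(n, 0)` -/

/-- **`(T_f(q) v)_b = (T_f(q⁰) v)_b + [b = n]·q_0·v_0`** with `q⁰ = q[0 ↦ 0]`: the only entry of `T_f` reading `q_0` is `(n, 0)`.
[cite: BourbakiAlgebre1a3, Ch. III §8] -/
theorem hankelT_mulVec_idealShape (n : ℕ) (q : ℕ → K) (v : Fin (n + 1) → K) (b : Fin (n + 1)) :
    (hankelT n q *ᵥ v) b = (hankelT n (Function.update q 0 0) *ᵥ v) b +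
      if (b : ℕ) = n then q 0 * v ⟨0, by omega⟩ else 0 := by
  have hb := b.isLt
  simp only [Matrix.mulVec, dotProduct, hankelT_apply]
  by_cases hbn : (b : ℕ) = n
  · rw [if_pos hbn, ← Finset.sum_erase_add _ _ (Finset.mem_univ (⟨0, by omega⟩ : Fin (n + 1))),
      ← Finset.sum_erase_add (Finset.univ) _ (Finset.mem_univ (⟨0, by omega⟩ : Fin (n + 1)))]
    have hidx : n - (b : ℕ) + ((⟨0, by omega⟩ : Fin (n + 1)) : ℕ) = 0 := by simp only; omega
    rw [hidx, Function.update_self, add_assoc]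
    congr 1
    · refine Finset.sum_congr rfl fun c hc => ?_
      have hc0 : (c : ℕ) ≠ 0 := by
        simp only [Finset.mem_erase, Finset.mem_univ, and_true, ne_eq, Fin.ext_iff] at hc
        exact hc
      rw [Function.update_of_ne (show n - (b : ℕ) + (c : ℕ) ≠ 0 by omega)]
    · simp only [pow_zero, Nat.choose_zero_right, Nat.cast_one, one_mul, mul_zero, zero_mul, zero_add]
  · rw [if_neg hbn, add_zero]
    refine Finset.sum_congr rfl fun c _ => ?_
    rw [Function.update_of_ne (show n - (b : ℕ) + (c : ℕ) ≠ 0 by omega)]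

/-- the `O_Z` part `q⁰ = q[0 ↦ 0]` of an `I_Z` shape is a leading shape: `q⁰_m = 0` for `m < n`, and `q⁰_n = q_n` (`1 ≤ n`). -/
theorem idealShape_update_zero {n : ℕ} (hn : 1 ≤ n) {q : ℕ → K} (hq : ∀ m, 1 ≤ m → m < n → q m = 0) :
    (∀ m, m < n → Function.update q 0 (0 : K) m = 0) ∧ Function.update q 0 (0 : K) n = q n := by
  refine ⟨fun m hm => ?_, Function.update_of_ne (by omega) _ _⟩
  rcases Nat.eq_zero_or_pos m with rfl | hm0
  · exact Function.update_self _ _ _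
  · rw [Function.update_of_ne (by omega)]
    exact hq m hm0 hm

/-- **row `n` at the extreme pin:** for even `n ≥ 1`, `q_0 ≠ 0`, an `I_Z` shape and `v ∈ ker(T_f(q) − q_n)`: `v_0 = 0`, and `v` lies in
`ker(T_f(q⁰) − q_n)` (the pivot `(−1)ⁿ C(n,n) q_n − q_n` of row `n` vanishes, so that row reads `q_0 v_0 = 0`).
[cite: BourbakiAlgebre1a3, Ch. III §8] -/
theorem apply_zero_eq_zero_of_mem_ker_idealShape_pin_zero {n : ℕ} (hn : 1 ≤ n) (heven : Even n) {q : ℕ → K}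
    (hq : ∀ m, 1 ≤ m → m < n → q m = 0) (hq0 : q 0 ≠ 0) {v : Fin (n + 1) → K}
    (hv : v ∈ LinearMap.ker (Matrix.toLin' (hankelT n q) - q n • LinearMap.id)) :
    v ⟨0, by omega⟩ = 0 ∧ v ∈ LinearMap.ker (Matrix.toLin' (hankelT n (Function.update q 0 0)) - q n • LinearMap.id) := by
  obtain ⟨hq0', hqn'⟩ := idealShape_update_zero hn hq
  rw [mem_ker_toLin'_sub_smul_iff] at hv
  -- row `n` of `T_f(q⁰) v = q_n v`: only the diagonal term survives and equals `q_n v_n`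
  have hrowO : (hankelT n (Function.update q 0 0) *ᵥ v) ⟨n, by omega⟩ = q n * v ⟨n, by omega⟩ := by
    simp only [Matrix.mulVec, dotProduct, hankelT_apply]
    rw [Finset.sum_eq_single (⟨n, by omega⟩ : Fin (n + 1))]
    · rw [show n - n + n = n by omega, hqn', Nat.choose_self, Nat.cast_one, mul_one, heven.neg_one_pow, one_mul]
    · intro c _ hc
      have hcl := c.isLt
      have hcn : (c : ℕ) < n := by
        have : (c : ℕ) ≠ n := fun h => hc (Fin.ext h)
        omega
      rw [show n - n + (c : ℕ) = c by omega, hq0' c hcn, mul_zero, zero_mul]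
    · intro h; exact absurd (Finset.mem_univ _) h
  have hrown := congr_fun hv ⟨n, by omega⟩
  rw [hankelT_mulVec_idealShape, if_pos rfl, hrowO, Pi.smul_apply, smul_eq_mul] at hrown
  have hv0 : v ⟨0, by omega⟩ = 0 := by
    have h : q 0 * v ⟨0, by omega⟩ = 0 := by linear_combination hrown
    exact (mul_eq_zero.mp h).resolve_left hq0
  refine ⟨hv0, ?_⟩
  rw [mem_ker_toLin'_sub_smul_iff]
  funext b
  have h := congr_fun hv b
  rw [hankelT_mulVec_idealShape, hv0, mul_zero] at h
  simpa using h

/-- **GENERIC `O_Z` tail ⇒ the `I_Z` row does NOT drop at the extreme pin through `T_f − q_n`:** even `n`, `I_Z` shape, `q_0 ≠ 0`,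
`q_n ≠ 0`, `det B_0 ≠ 0` (`B_0` the `n × n` pin block of `T_f(q⁰) − q_n`) ⇒ `ker(T_f(q) − q_n) = ⊥`.
[cite: BourbakiAlgebre1a3, Ch. III §8] [cite: BuchweitzFlenner2008HH, Prop. 6.4.4] -/
theorem ker_hankelT_idealShape_pin_zero_eq_bot [CharZero K] {n : ℕ} (hn : 1 ≤ n) (heven : Even n) {q : ℕ → K}
    (hq : ∀ m, 1 ≤ m → m < n → q m = 0) (hq0 : q 0 ≠ 0) (hqn : q n ≠ 0) {B : Matrix (Fin n) (Fin n) K}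
    (hB : B = Matrix.of fun r s : Fin n =>
      (hankelT n (Function.update q 0 0) - q n • (1 : Matrix (Fin (n + 1)) (Fin (n + 1)) K)) ⟨0 + r, by omega⟩
        ⟨0 + 1 + s, by omega⟩)
    (hdet : B.det ≠ 0) : LinearMap.ker (Matrix.toLin' (hankelT n q) - q n • LinearMap.id) = ⊥ := by
  obtain ⟨hq0', hqn'⟩ := idealShape_update_zero hn hq
  rw [Submodule.eq_bot_iff]
  intro v hv
  obtain ⟨hv0, hvO⟩ := apply_zero_eq_zero_of_mem_ker_idealShape_pin_zero hn heven hq hq0 hv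
  have hμ : q n = (-1 : K) ^ 0 * (n.choose 0 : K) * Function.update q 0 (0 : K) n := by
    rw [hqn', pow_zero, Nat.choose_zero_right, Nat.cast_one, one_mul, one_mul]
  exact eq_zero_of_mem_ker_hankelT_pin (show n = 0 + n + 0 by omega) heven hq0' (by rw [hqn']; exact hqn) hμ hB hdet hvO hv0

/-- **DEGENERATE `O_Z` tail ⇒ the `I_Z` row DROPS BY EXACTLY ONE through `T_f − q_n`:** even `n`, `I_Z` shape, `q_0 ≠ 0`,
`q_n ≠ 0`, `det B_0 = 0` ⇒ `dim ker(T_f(q) − q_n) = 1` (`≥ 1`: the `2`-dimensional `ker(T_f(q⁰) − q_n)` has a vector with `v_0 = 0`,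
which is a kernel vector of `T_f(q) − q_n`; `≤ 1`: on that kernel `v_0 = 0`, so `v ↦ v_n` is injective by back substitution).
[cite: BourbakiAlgebre1a3, Ch. III §8] [cite: BuchweitzFlenner2008HH, Prop. 6.4.4] -/
theorem finrank_ker_hankelT_idealShape_pin_zero [CharZero K] {n : ℕ} (hn : 1 ≤ n) (heven : Even n) {q : ℕ → K}
    (hq : ∀ m, 1 ≤ m → m < n → q m = 0) (hq0 : q 0 ≠ 0) (hqn : q n ≠ 0) {B : Matrix (Fin n) (Fin n) K}
    (hB : B = Matrix.of fun r s : Fin n =>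
      (hankelT n (Function.update q 0 0) - q n • (1 : Matrix (Fin (n + 1)) (Fin (n + 1)) K)) ⟨0 + r, by omega⟩
        ⟨0 + 1 + s, by omega⟩)
    (hdet : B.det = 0) : Module.finrank K ↥(LinearMap.ker (Matrix.toLin' (hankelT n q) - q n • LinearMap.id)) = 1 := by
  obtain ⟨hq0', hqn'⟩ := idealShape_update_zero hn hq
  have hqn0 : Function.update q 0 (0 : K) n ≠ 0 := by rw [hqn']; exact hqn
  have hμ : q n = (-1 : K) ^ 0 * (n.choose 0 : K) * Function.update q 0 (0 : K) n := by
    rw [hqn', pow_zero, Nat.choose_zero_right, Nat.cast_one, one_mul, one_mul]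
  have ht : (-1 : K) ^ n * (q n * q n) = (-1 : K) ^ n * ((n.choose 0 : K) * (n.choose 0 : K)) *
      (Function.update q 0 (0 : K) n * Function.update q 0 (0 : K) n) := by
    rw [hqn', Nat.choose_zero_right, Nat.cast_one, one_mul, mul_one]
  set W := LinearMap.ker (Matrix.toLin' (hankelT n q) - q n • LinearMap.id) with hW
  set WO := LinearMap.ker (Matrix.toLin' (hankelT n (Function.update q 0 0)) - q n • LinearMap.id) with hWO
  -- `dim WO = 2` by the pin criterion on the `O_Z` part
  have hWO2 : Module.finrank K ↥WO = 2 := by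
    rw [hWO, ← finrank_ker_middleM_leading_pin_even heven hq0' hqn0 (a := 0) (by omega) hμ ht]
    exact finrank_ker_middleM_leading_pin_of_det_eq_zero (show n = 0 + n + 0 by omega) heven hq0' hqn0 hμ ht hB hdet
  refine le_antisymm ?_ ?_
  · -- `≤ 1`: `v ↦ v_n` is injective on `W`
    let f : ↥W →ₗ[K] K := (LinearMap.proj (⟨n, by omega⟩ : Fin (n + 1))) ∘ₗ W.subtype
    have hf : Function.Injective f := by
      rw [← LinearMap.ker_eq_bot, LinearMap.ker_eq_bot']
      intro v hv
      have hvn : (v : Fin (n + 1) → K) ⟨n, by omega⟩ = 0 := by simpa [f] using hv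
      obtain ⟨hv0, hvO⟩ := apply_zero_eq_zero_of_mem_ker_idealShape_pin_zero hn heven hq hq0 v.2
      rw [toLin'_sub_smul_id, LinearMap.mem_ker, Matrix.toLin'_apply] at hvO
      obtain ⟨-, -, hpiv⟩ := hankelT_sub_pin_diag (show n = 0 + n + 0 by omega) heven hqn0 hμ
      exact Subtype.ext (eq_zero_of_mulVec_eq_zero_of_apply_two_pivots
        (blockTriangular_hankelT_leading_sub hq0' (q n)) (i := 0) (k := n) (by omega) hpiv hvO hv0
        (by simpa using hvn))
    have h := LinearMap.finrank_le_finrank_of_injective hf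
    rwa [Module.finrank_self] at h
  · -- `≥ 1`: the kernel of `v ↦ v_0` on `WO` is non-trivial and maps into `W`
    let g : ↥WO →ₗ[K] K := (LinearMap.proj (⟨0, by omega⟩ : Fin (n + 1))) ∘ₗ WO.subtype
    have hker : 1 ≤ Module.finrank K ↥(LinearMap.ker g) := by
      have h1 := LinearMap.finrank_range_add_finrank_ker g
      have h2 : Module.finrank K ↥(LinearMap.range g) ≤ 1 := by
        have := Submodule.finrank_le (LinearMap.range g)
        rwa [Module.finrank_self] at this
      rw [hWO2] at h1
      omega
    have hmem : ∀ w : ↥WO, g w = 0 → (w : Fin (n + 1) → K) ∈ W := by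
      intro w hw
      have hw0 : (w : Fin (n + 1) → K) ⟨0, by omega⟩ = 0 := by simpa [g] using hw
      have hwO : (w : Fin (n + 1) → K) ∈
          LinearMap.ker (Matrix.toLin' (hankelT n (Function.update q 0 0)) - q n • LinearMap.id) := w.2
      rw [mem_ker_toLin'_sub_smul_iff] at hwO
      rw [mem_ker_toLin'_sub_smul_iff]
      funext b
      rw [hankelT_mulVec_idealShape n q _ b, hw0, mul_zero, congr_fun hwO b]
      simp
    let ι : ↥(LinearMap.ker g) →ₗ[K] ↥W :=
      { toFun := fun w => ⟨(w.1 : Fin (n + 1) → K), hmem w.1 w.2⟩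
        map_add' := by intro w w'; rfl
        map_smul' := by intro r w; rfl }
    have hι : Function.Injective ι := by
      intro w w' h
      have h' := congrArg Subtype.val h
      exact Subtype.ext (Subtype.ext h')
    exact le_trans hker (LinearMap.finrank_le_finrank_of_injective hι)

/-- **`dim ker(T_f(q) + q_n) ≤ 1` for an `I_Z` shape, even `n`, `q_n ≠ 0`:** `v ↦ v_0` is injective on that kernel, because
`T_f(q⁰) + q_n` is triangular with no zero pivot (`Mod4LeadingTermPinsEven`). [cite: BourbakiAlgebre1a3, Ch. III §8] -/
theorem finrank_ker_hankelT_idealShape_add_pin_zero_le_one [CharZero K] {n : ℕ} (hn : 1 ≤ n) (heven : Even n) {q : ℕ → K}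
    (hq : ∀ m, 1 ≤ m → m < n → q m = 0) (hqn : q n ≠ 0) :
    Module.finrank K ↥(LinearMap.ker (Matrix.toLin' (hankelT n q) + q n • LinearMap.id)) ≤ 1 := by
  obtain ⟨hq0', hqn'⟩ := idealShape_update_zero hn hq
  have hqn0 : Function.update q 0 (0 : K) n ≠ 0 := by rw [hqn']; exact hqn
  have hμ : q n = (-1 : K) ^ 0 * (n.choose 0 : K) * Function.update q 0 (0 : K) n := by
    rw [hqn', pow_zero, Nat.choose_zero_right, Nat.cast_one, one_mul, one_mul]
  have hbot := ker_hankelT_add_pin_eq_bot_of_even heven hq0' hqn0 (a := 0) (by omega) hμ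
  set W := LinearMap.ker (Matrix.toLin' (hankelT n q) + q n • LinearMap.id) with hW
  let f : ↥W →ₗ[K] K := (LinearMap.proj (⟨0, by omega⟩ : Fin (n + 1))) ∘ₗ W.subtype
  have hf : Function.Injective f := by
    rw [← LinearMap.ker_eq_bot, LinearMap.ker_eq_bot']
    intro v hv
    have hv0 : (v : Fin (n + 1) → K) ⟨0, by omega⟩ = 0 := by simpa [f] using hv
    have hvW : (v : Fin (n + 1) → K) ∈ LinearMap.ker (Matrix.toLin' (hankelT n q) + q n • LinearMap.id) := v.2
    rw [mem_ker_toLin'_add_smul_iff] at hvW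
    have hvO : (v : Fin (n + 1) → K) ∈
        LinearMap.ker (Matrix.toLin' (hankelT n (Function.update q 0 0)) + q n • LinearMap.id) := by
      rw [mem_ker_toLin'_add_smul_iff]
      funext b
      rw [← congr_fun hvW b, hankelT_mulVec_idealShape n q _ b, hv0, mul_zero]
      simp
    rw [hbot, Submodule.mem_bot] at hvO
    exact Subtype.ext hvO
  have h := LinearMap.finrank_le_finrank_of_injective hf
  rwa [Module.finrank_self] at h

/-- **THE `I_Z` MIDDLE ENTRY AT THE EXTREME PIN `t_0 = q_n²` (even `n`), DEGENERATE `O_Z` tail (`det B_0 = 0`):**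
`dim ker(M_f(q) − t_0) = 1 + dim ker(T_f(q) + q_n)` (the second summand `≤ 1`). [cite: BourbakiAlgebre1a3, Ch. III §8]
[cite: BuchweitzFlenner2008HH, Prop. 6.4.4] -/
theorem finrank_ker_middleM_idealShape_pin_zero_of_det_eq_zero [CharZero K] {n : ℕ} (hn : 1 ≤ n) (heven : Even n) {q : ℕ → K}
    (hq : ∀ m, 1 ≤ m → m < n → q m = 0) (hq0 : q 0 ≠ 0) (hqn : q n ≠ 0) {t : K} (ht : t = q n * q n)
    {B : Matrix (Fin n) (Fin n) K}
    (hB : B = Matrix.of fun r s : Fin n =>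
      (hankelT n (Function.update q 0 0) - q n • (1 : Matrix (Fin (n + 1)) (Fin (n + 1)) K)) ⟨0 + r, by omega⟩
        ⟨0 + 1 + s, by omega⟩)
    (hdet : B.det = 0) :
    Module.finrank K ↥(LinearMap.ker (Matrix.toLin' (middleM n q) - t • LinearMap.id)) =
      1 + Module.finrank K ↥(LinearMap.ker (Matrix.toLin' (hankelT n q) + q n • LinearMap.id)) := by
  have ht' : t = (-1 : K) ^ n * (q n * q n) := by rw [ht, heven.neg_one_pow, one_mul]
  rw [finrank_ker_middleM_eq_add q hqn ht', finrank_ker_hankelT_idealShape_pin_zero hn heven hq hq0 hqn hB hdet]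

/-- **THE `I_Z` MIDDLE ENTRY AT THE EXTREME PIN `t_0 = q_n²` (even `n`), GENERIC `O_Z` tail (`det B_0 ≠ 0`):**
`dim ker(M_f(q) − t_0) = dim ker(T_f(q) + q_n) ≤ 1`. [cite: BourbakiAlgebre1a3, Ch. III §8] [cite: BuchweitzFlenner2008HH, Prop. 6.4.4] -/
theorem finrank_ker_middleM_idealShape_pin_zero_of_det_ne_zero [CharZero K] {n : ℕ} (hn : 1 ≤ n) (heven : Even n) {q : ℕ → K}
    (hq : ∀ m, 1 ≤ m → m < n → q m = 0) (hq0 : q 0 ≠ 0) (hqn : q n ≠ 0) {t : K} (ht : t = q n * q n)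
    {B : Matrix (Fin n) (Fin n) K}
    (hB : B = Matrix.of fun r s : Fin n =>
      (hankelT n (Function.update q 0 0) - q n • (1 : Matrix (Fin (n + 1)) (Fin (n + 1)) K)) ⟨0 + r, by omega⟩
        ⟨0 + 1 + s, by omega⟩)
    (hdet : B.det ≠ 0) :
    Module.finrank K ↥(LinearMap.ker (Matrix.toLin' (middleM n q) - t • LinearMap.id)) =
      Module.finrank K ↥(LinearMap.ker (Matrix.toLin' (hankelT n q) + q n • LinearMap.id)) := by
  have ht' : t = (-1 : K) ^ n * (q n * q n) := by rw [ht, heven.neg_one_pow, one_mul]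
  rw [finrank_ker_middleM_eq_add q hqn ht', ker_hankelT_idealShape_pin_zero_eq_bot hn heven hq hq0 hqn hB hdet, finrank_bot,
    zero_add]

/-- **so the `I_Z` middle drop at the extreme pin is at most `2`**, and at most `1` off the `O_Z` drop-2 hypersurface.
[cite: BourbakiAlgebre1a3, Ch. III §8] [cite: BuchweitzFlenner2008HH, Prop. 6.4.4] -/
theorem finrank_ker_middleM_idealShape_pin_zero_le_two [CharZero K] {n : ℕ} (hn : 1 ≤ n) (heven : Even n) {q : ℕ → K}
    (hq : ∀ m, 1 ≤ m → m < n → q m = 0) (hq0 : q 0 ≠ 0) (hqn : q n ≠ 0) {t : K} (ht : t = q n * q n) :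
    Module.finrank K ↥(LinearMap.ker (Matrix.toLin' (middleM n q) - t • LinearMap.id)) ≤ 2 := by
  set B : Matrix (Fin n) (Fin n) K := Matrix.of fun r s : Fin n =>
      (hankelT n (Function.update q 0 0) - q n • (1 : Matrix (Fin (n + 1)) (Fin (n + 1)) K)) ⟨0 + r, by omega⟩
        ⟨0 + 1 + s, by omega⟩ with hB
  have hle := finrank_ker_hankelT_idealShape_add_pin_zero_le_one hn heven hq hqn
  by_cases hdet : B.det = 0
  · rw [finrank_ker_middleM_idealShape_pin_zero_of_det_eq_zero hn heven hq hq0 hqn ht hB hdet]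
    omega
  · rw [finrank_ker_middleM_idealShape_pin_zero_of_det_ne_zero hn heven hq hq0 hqn ht hB hdet]
    omega

end Summit.Ventures.HSemireg.Mod4
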